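import Summits.Ventures.GridStability.Lyapunov.ClassicalSwingPolytopeRoa
import Summits.Ventures.GridStability.Lyapunov.StructurePreservingPolytopeLevel
import Summits.Ventures.GridStability.Lyapunov.WSCC9LffNonUniformRegion
import HarnessLib

/-!
# GridStability/Lyapunov/WSCC9LosslessPolytopeRoa — the LOSSLESS 9-bus variant WITH THE PRINTED
# NON-UNIFORM DAMPING («WSCC9-postB-L-SPdamp», the object of ★★ «#80′») on Vu–Turitsyn's polytope:
# an EXPLICIT solver-free synchronisation level `c = 27/100` for model-1's `data.toModel`

Cell `gridfusion` (LADDER-GRIDFUSION), seat gridfusion-lyap-1 (g6); brief «LFF-NU-SPARSE» (lead RULINGs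
6i (5) / 6j (1)) in its literal, network-reduced form, through ★ #91's polytope theorem read with
`gen = univ` (`Lyapunov/ClassicalSwingPolytopeRoa.lean`, `ClassicalSwingPolytope.polytope_synchronisation`).
OBJECT BY NAME: g4's `WSCC9LffNU.data : RecastData 2` (`Lyapunov/WSCC9LffNonUniformData.lean` p504302 =
model-1's `WSCC9.postB_relL` with the PRINTED non-uniform damping `D := WSCC9.D_SP`,
`D_i/M_i = 1/10, 1/5, 3/10` [cite: SauerPai1998, §7.9.3 Ex. 7.1]; LABEL OF EVERY MENTION: «synthetic
lossless VARIANT of the printed 9-bus with the printed NON-UNIFORM damping — a PIPELINE sentence, not a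
9-bus sentence»; tokens MV-2L synthetic + MV-RD + MV-SPD + MV-h12) and its real model `data.toModel :
ClassicalSwing 3`; equilibrium angles `data.angleOf` (exact circle points, g4's `data_eqData`). Compare
★★ «#80′ WSCC9-NU-ROA» (p526132/p527010/p528165): THERE the LFF certificate on Pai's machine-reference
space gives a synchronisation region with an EXISTENTIAL level `c₀ > V(0)` (explicit only through the
rank-one tables of p505678); HERE the level is the CLOSED FORM `c < C_ij·vtGap(θ*_ij)` of the Bergen–Hill
/ Vu–Turitsyn energy, read on absolute angles with the momentum leaf — no `Ñ⁻¹`, no Gram certificate, no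
rank-one fact.

THREE COLUMNS. CERTIFIED (kernel, here): `pairChecks` — ONE `decide` over `ℚ` on the 6 ordered machine
pairs: `27/100 < C_ij·(2·cd_ij − (3.141593 − 2|sd_ij|)·|sd_ij|)` with `cd_ij = c_ic_j + s_is_j = cos θ*_ij`,
`sd_ij = s_ic_j − c_is_j = sin θ*_ij` EXACT (model-1's `cd_cast`/`sd_cast`); hence `level_lt_pairGap`:
`27/100 < C_ij·vtGap(θ*_i − θ*_j)` for `i ≠ j` (binding pair machines 0–1: `θ*_01 = −39.95°`,
`C_01 = 0.806`, rational bound `C·ratGap = 0.2745` against the float `C·vtGap = 0.3316` — at a 40° line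
angle the substitution `|θ*| ↦ |sin θ*|` inside `(π − 2|θ*|)` costs 17 %; a sharper `arctan` lower bound
would certify `c ≈ 0.32`; the kernel fact is the inequality as stated); the data facts of `ClassicalSwingPolytope.polytope_synchronisation` for `data.toModel`
(`M, D > 0`, `B` symmetric, lossless, `C ≥ 0`, the 3-machine coupling graph preconnected by the star at
machine 0, `|θ*_ij| < π/2` = g4's `abs_δs_lt`, equilibrium = model-1's `isEquilibrium_of_eqData`); and the
sentence `polytope_synchronisation`: for EVERY solution of `data.toModel` on `univ` from the polytope
`|(δ_i − δ_j) + (θ*_i − θ*_j)| < π` on the momentum leaf with `V ≤ 27/100`, the polytope and `V ≤ 27/100`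
hold for all `t ≥ 0` and `(δ, ω) → (θ*, 0)`. MODELLED: the LABEL above. VALIDATED: nothing (no SDP
anywhere). No sentence of this file says that the WSCC system or any grid is stable. No definition; no
named fact; standard axioms.
-/

noncomputable section

open Set Filter Topology Real Finset
open Summit.Ventures.GridStability.Models
open Summit.Ventures.GridStability.Models.StructurePreserving
open Summit.Ventures.GridStability.Lyapunov.StructurePreserving (vtGap_ge_d6)
open Summit.Ventures.GridStability.Lyapunov.ClassicalSwingPolytope
open Summit.Ventures.GridStability.Lyapunov.WSCC9LffNU (data data_eqData data_acute data_circle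
  data_Cc_pos data_M_pos data_G_off abs_δs_lt data_D_pos data_B_symm)
open Literature.MathematicalPhysics.PowerSystems.ClassicalModel.LosslessSystem (vtGap)

namespace Summit.Ventures.GridStability.Lyapunov.WSCC9LosslessPolytope

/-! ### The six per-pair kernel checks over `ℚ` -/

/-- **Per-pair level checks (one `decide` over `ℚ`)**: for every ordered pair of distinct machines,
`27/100 < C_ij·(2·cd_ij − (3.141593 − 2|sd_ij|)·|sd_ij|)` on the exact data of «WSCC9-postB-L-SPdamp»
(binding pair machines 0–1, bound `0.2745`). CERTIFIED column. [cite: VuTuritsyn2016, Appendix 9.3] -/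
theorem pairChecks : ∀ i j : Fin 3, i ≠ j →
    (27 / 100 : ℚ) < data.Cc i j
      * (2 * data.cd i j - (3141593 / 1000000 - 2 * |data.sd i j|) * |data.sd i j|) := by
  decide +kernel

/-! ### The data facts of the polytope theorem for `data.toModel` -/

/-- The coupling coefficient of the real model is the rational `C_ij`. [folklore] -/
theorem Ccoef_eq (i j : Fin 3) : data.toModel.Ccoef i j = (data.Cc i j : ℝ) := by
  simp only [ClassicalSwing.Ccoef, RecastData.toModel, RecastData.Cc]
  push_cast
  ring

/-- Positive inertias (reals). -/
theorem M_pos (i : Fin 3) : 0 < data.toModel.M i := by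
  show (0 : ℝ) < ((data.M i : ℚ) : ℝ)
  exact_mod_cast data_M_pos i

/-- Positive dampings (reals; the printed non-uniform `D_SP`). -/
theorem D_pos (i : Fin 3) : 0 < data.toModel.D i := by
  show (0 : ℝ) < ((data.D i : ℚ) : ℝ)
  exact_mod_cast data_D_pos i

/-- Symmetric susceptances (reals). -/
theorem B_symm (i j : Fin 3) : data.toModel.B i j = data.toModel.B j i := by
  show ((data.B i j : ℚ) : ℝ) = ((data.B j i : ℚ) : ℝ)
  exact_mod_cast data_B_symm i j

/-- Lossless (reals): `G_ij = 0` off the diagonal. -/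
theorem isLossless : data.toModel.IsLossless := fun i j hij => by
  show ((data.G i j : ℚ) : ℝ) = 0
  rw [data_G_off i j hij]; push_cast; rfl

/-- Nonnegative (indeed positive) couplings off the diagonal. -/
theorem Ccoef_pos {i j : Fin 3} (hij : i ≠ j) : 0 < data.toModel.Ccoef i j := by
  rw [Ccoef_eq]; exact_mod_cast data_Cc_pos i j hij

/-- **The 3-machine coupling graph is preconnected** (star at machine `0`: every `C_0j > 0`). -/
theorem preconnected : (spParams data.toModel).couplingGraph.Preconnected := by
  refine (spParams data.toModel).couplingGraph_preconnected_of_parent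
    (spParams_b_symm data.toModel B_symm) 0 (fun _ => 0) (fun v => if v = 0 then 0 else 1)
    (fun v hv => hv.symm ∘ Eq.symm ∘ Eq.symm) ?_ ?_
  · intro v hv
    rw [spParams_b_of_ne data.toModel (Ne.symm hv)]
    exact (Ccoef_pos (Ne.symm hv)).ne'
  · intro v hv
    simp [hv]

/-- Equilibrium line angles strictly inside `(−π/2, π/2)` on every pair (acute circle points). -/
theorem abs_angle_lt {i j : Fin 3} (hij : i ≠ j) : |data.angleOf i - data.angleOf j| < π / 2 :=
  abs_δs_lt ⟨(i, j), hij⟩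

/-- `θ* = angleOf` is an equilibrium of the real model (model-1's `isEquilibrium_of_eqData`). -/
theorem isEquilibrium : data.toModel.IsEquilibrium data.angleOf :=
  data.isEquilibrium_of_eqData data_eqData

/-- **The certified per-pair level**: `27/100 < C_ij·vtGap(θ*_i − θ*_j)` for `i ≠ j` (from `pairChecks`,
the exact `cos θ*_ij = cd_ij`, `sin θ*_ij = sd_ij`, and `vtGap_ge_d6`). CERTIFIED column.
[cite: VuTuritsyn2016, §IV (third construction) and Appendix 9.3] -/
theorem level_lt_pairGap {i j : Fin 3} (hij : i ≠ j) (_hC : data.toModel.Ccoef i j ≠ 0) :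
    (27 / 100 : ℝ) < data.toModel.Ccoef i j * vtGap (data.angleOf i - data.angleOf j) := by
  have hq := (Rat.cast_lt (K := ℝ)).2 (pairChecks i j hij)
  push_cast at hq
  have hcd : (data.cd i j : ℝ) = Real.cos (data.angleOf i - data.angleOf j) := data.cd_cast data_eqData i j
  have hsd : (data.sd i j : ℝ) = Real.sin (data.angleOf i - data.angleOf j) := data.sd_cast data_eqData i j
  rw [hcd, hsd] at hq
  have hgap := vtGap_ge_d6 (d := data.angleOf i - data.angleOf j)
    (by linarith [(abs_angle_lt hij).le, Real.pi_pos])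
  rw [Ccoef_eq]
  have hC : (0 : ℝ) ≤ (data.Cc i j : ℝ) := by exact_mod_cast (data_Cc_pos i j hij).le
  calc (27 / 100 : ℝ) < (data.Cc i j : ℝ) * (2 * Real.cos (data.angleOf i - data.angleOf j)
        - (3141593 / 1000000 - 2 * |Real.sin (data.angleOf i - data.angleOf j)|)
          * |Real.sin (data.angleOf i - data.angleOf j)|) := hq
    _ ≤ (data.Cc i j : ℝ) * vtGap (data.angleOf i - data.angleOf j) :=
        mul_le_mul_of_nonneg_left (by norm_num at hgap ⊢; exact hgap) hC

/-! ### The sentence -/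

/-- **«WSCC9-postB-L-SPdamp» on Vu–Turitsyn's polytope — solver-free synchronisation with the EXPLICIT
level `27/100`.** For model-1's real model `data.toModel` (3 machines, PRINTED non-uniform damping
`D_i/M_i = 1/10, 1/5, 3/10`, lossless post-B couplings): every solution `γ = (δ, ω)` on `univ`
(tree convention) whose initial state has every machine pair in the polytope
`|(δ_i − δ_j) + (θ*_i − θ*_j)| < π`, lies on the momentum leaf `Σ M_iω_i(0) + Σ D_iδ_i(0) = Σ D_iθ*_i`
and has energy `V(θ*; δ(0), ω(0)) ≤ 27/100` keeps the polytope and `V ≤ 27/100` for all `t ≥ 0` and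
converges to `(θ*, 0)`: all three speed deviations `→ 0`, all three rotor angles `→ θ*`. LABEL:
synthetic lossless VARIANT of the printed 9-bus with the printed non-uniform damping — a PIPELINE
sentence, not a 9-bus sentence; no sentence here says a grid is stable.
[cite: VuTuritsyn2016, §IV; SauerPai1998, §7.9.3 eqs. (7.215)–(7.216)] -/
theorem polytope_synchronisation {γ : ℝ → ClassicalSwing.State 3}
    (hγ : data.toModel.IsSolutionOn γ univ)
    (hpol : ∀ i j, i ≠ j → data.toModel.Ccoef i j ≠ 0 →
      |((γ 0).1 i - (γ 0).1 j) + (data.angleOf i - data.angleOf j)| < π)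
    (hL : ∑ i, data.toModel.M i * (γ 0).2 i + ∑ i, data.toModel.D i * (γ 0).1 i
      = ∑ i, data.toModel.D i * data.angleOf i)
    (hV : (spParams data.toModel).energy data.angleOf (γ 0).1 (γ 0).2 ≤ 27 / 100) :
    (∀ t, 0 ≤ t →
        (∀ i j, i ≠ j → data.toModel.Ccoef i j ≠ 0 →
          |((γ t).1 i - (γ t).1 j) + (data.angleOf i - data.angleOf j)| < π) ∧
        (spParams data.toModel).energy data.angleOf (γ t).1 (γ t).2 ≤ 27 / 100) ∧
      Tendsto γ atTop (𝓝 (data.angleOf, 0)) :=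
  ClassicalSwingPolytope.polytope_synchronisation data.toModel (by decide) M_pos D_pos B_symm
    isLossless (fun _ _ hij => (Ccoef_pos hij).le) preconnected isEquilibrium
    (fun _ _ hij _ => abs_angle_lt hij) (fun _ _ hij hC => level_lt_pairGap hij hC) hγ hpol hL hV

end Summit.Ventures.GridStability.Lyapunov.WSCC9LosslessPolytope

end
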